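import Literature.Topology.FourManifolds.MMSWPictureSectionsCore
import HarnessLib

/-!
# The model identification covers the surgered manifold; the glue relation of the last torus

Topic `Literature/Topology/FourManifolds`; part of the proof of the named fact
`Literature.Topology.FourManifolds.pictureSurgeryPresentation` (`MMSWPictureSurgery.lean`; Kirby,
*The Topology of 4-Manifolds*, LNM 1374 (1989), Ch. I §2, Lemma 2.1).  Everything here is proved;
no named fact is introduced.

For the gluing data `G : Gluing k η Y` we prove that `G.map '' (M_k ∖ K)` together with the last
glued-in solid torus covers `Y` (`cover'`), and the glue relation between `G.map` and the last solid
torus (`map_eq_JB_last_iff`).  The covering uses the intermediate value sweeps of the radial collar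
package: every point of the link complement is a virtual sphere point or an outer core point of a
point of `M_k ∖ K` (`mem_image_of_mem_LC`), and every core point of a glued-in torus of a dotted
circle is the image of an inner core point (`exists_core_inner`).

## References

* R. Kirby, *The Topology of 4-Manifolds*, LNM 1374 (1989), Ch. I §2. [Kirby1989]
-/

open scoped Manifold ContDiff Topology Real ComplexConjugate
open Function Set Metric Filter

noncomputable section

namespace Literature.Topology.FourManifolds

/-- Local notation: `𝔼 n` is the model Euclidean space `EuclideanSpace ℝ (Fin n)`. -/
local notation "𝔼 " n:arg => EuclideanSpace ℝ (Fin n)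
/-- Local notation: `𝕊 n` is the unit sphere of `EuclideanSpace ℝ (Fin (n + 1))`. -/
local notation "𝕊 " n:arg => (Metric.sphere (0 : EuclideanSpace ℝ (Fin (n + 1))) 1)

namespace MMSW

open Literature.AlgebraicTopology.Homotopy.HopfFibration (zC wC)

variable {k : ℕ} {η : ℝ}

/-! ## Estimates beyond the outer core -/

/-- **Beyond the outer core the potential is small**: for `c_k + 1/60 ≤ s < 1` and
`|Z_k(e, s)| ≥ 20(k+1)`, `g_k(Z_k(e, s)) < 19/20`. [folklore] -/
theorem planarPot_outerZ_lt_of_high {e : 𝔼 2} (he : ‖e‖ = 1) {s : ℝ} (hs : latC k + 1 / 60 ≤ s)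
    (hs1 : s < 1) (hfar : 20 * ((k : ℝ) + 1) ≤ ‖outerZ k e s‖) :
    planarPot k (outerZ k e s) < 19 / 20 := by
  have hc := lt_latC (k := k)
  have hs0 : 0 < s := by linarith
  have ha := focal_pos (k := k)
  have ha1 := lt_focal (k := k)
  have hC : drawRadius k = 100 * ((k : ℝ) + 1) := rfl
  have hR : bigRadius k = 40 * ((k : ℝ) + 1) := rfl
  have hk : (0 : ℝ) ≤ k := Nat.cast_nonneg k
  have hD := one_sub_sqrt_mul_pos hs0 he.le
  -- `D < 2`
  have hD2 : 1 - Real.sqrt (1 - s ^ 2) * e 1 < 2 := by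
    have h1 : Real.sqrt (1 - s ^ 2) < 1 := (Real.sqrt_lt' one_pos).2 (by nlinarith)
    have h0 : 0 ≤ Real.sqrt (1 - s ^ 2) := Real.sqrt_nonneg _
    have he1 := abs_le.1 (abs_apply_le_one_of_norm_eq_one he 1)
    nlinarith [he1.1]
  -- `a − C s ≤ −C/60`
  have hnum : focal k - drawRadius k * s ≤ -(drawRadius k / 60) := by
    rw [← drawRadius_mul_latC]
    have hCpos := drawRadius_pos' (k := k)
    nlinarith
  have hsq := normSq_outerZ he hs0 hs1.le (k := k)
  have hCpos := drawRadius_pos' (k := k)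
  have hquot : 2 * focal k * (focal k - drawRadius k * s) / (1 - Real.sqrt (1 - s ^ 2) * e 1) ≤
      -(focal k * drawRadius k / 60) := by
    rw [div_le_iff₀ hD]
    have h1 : 2 * focal k * (focal k - drawRadius k * s) ≤ 2 * focal k * (-(drawRadius k / 60)) :=
      mul_le_mul_of_nonneg_left hnum (by linarith)
    have h2 : 0 ≤ focal k * drawRadius k / 60 * (2 - (1 - Real.sqrt (1 - s ^ 2) * e 1)) :=
      mul_nonneg (div_nonneg (mul_pos ha hCpos).le (by norm_num)) (by linarith)
    nlinarith
  have hquot' : 2 * focal k * (focal k - drawRadius k * s) / (1 - Real.sqrt (1 - s ^ 2) * e 1) ≤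
      -(91 * ((k : ℝ) + 1) * (100 * ((k : ℝ) + 1)) / 60) := by
    refine hquot.trans ?_
    rw [hC]
    have := mul_lt_mul_of_pos_right ha1 (show (0 : ℝ) < 100 * ((k : ℝ) + 1) / 60 by positivity)
    nlinarith
  have hmain : Complex.normSq (outerZ k e s) / bigRadius k ^ 2 ≤ 91 / 100 := by
    rw [div_le_iff₀ (pow_pos bigRadius_pos 2), hsq, hR]
    have hK : 0 ≤ ((k : ℝ) + 1) ^ 2 := sq_nonneg _
    nlinarith
  rw [planarPot_eq_bigRadius]
  have hsum := sum_inv_normSq_le_of_far hfar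
  linarith

/-- A far planar point off the focus whose latitude exceeds `c_k + 1/60` has potential `< 19/20`.
[folklore] -/
theorem planarPot_lt_of_latS_gt {ζ : ℂ} (hfar : 20 * ((k : ℝ) + 1) ≤ ‖ζ‖) (hco : coLat k ζ ≠ 0)
    (hs : latC k + 1 / 60 < latS k ζ) : planarPot k ζ < 19 / 20 := by
  have h := planarPot_outerZ_lt_of_high (norm_coLatDir hco) hs.le (latS_lt_one_of_coLat_ne_zero hco)
    (by rw [outerZ_coLatDir_latS]; exact hfar)
  rwa [outerZ_coLatDir_latS] at h

/-- `ρ(m) ≤ m/2` for `m ≥ 0`. [folklore] -/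
theorem thinRad_le_half_self {m : ℝ} (hm : 0 ≤ m) : thinRad m ≤ m / 2 := by
  rw [thinRad]
  have h1 : 1 ≤ Real.sqrt (1 + m ^ 2) := Real.one_le_sqrt.2 (by nlinarith)
  rw [div_le_div_iff₀ (by positivity) two_pos]
  nlinarith

/-! ## The endpoints of the sweeps near a hole -/

/-- At distance exactly `27/20` from a hole the potential is `< 19/20`. [folklore] -/
theorem planarPot_lt_at_edge (j : Fin k) {v : ℂ} (hv : ‖v‖ = 1) :
    planarPot k (holeCentre k j + (((27 : ℝ) / 20 : ℝ) : ℂ) * v) < 19 / 20 := by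
  by_contra h
  push Not at h
  have hk : (0 : ℝ) ≤ k := Nat.cast_nonneg k
  have hr : ‖holeCentre k j + (((27 : ℝ) / 20 : ℝ) : ℂ) * v - holeCentre k j‖ = 27 / 20 := by
    rw [add_sub_cancel_left, norm_mul, Complex.norm_real, hv, mul_one, Real.norm_of_nonneg (by norm_num)]
  rcases far_or_near_of_le_planarPot h with hfar | ⟨i, hi⟩
  · rw [bigRadius] at hfar
    have h1 : ‖holeCentre k j + (((27 : ℝ) / 20 : ℝ) : ℂ) * v‖ ≤ ‖holeCentre k j‖ + 27 / 20 := by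
      calc _ ≤ ‖holeCentre k j‖ + ‖(((27 : ℝ) / 20 : ℝ) : ℂ) * v‖ := norm_add_le _ _
        _ = _ := by rw [norm_mul, Complex.norm_real, hv, mul_one, Real.norm_of_nonneg (by norm_num)]
    have h2 := norm_holeCentre_le (r := k) j
    linarith
  · by_cases hij : i = j
    · subst hij; linarith
    · have := norm_sub_holeCentre_ge_of_near hr.le hij
      linarith

/-- **The outer endpoint of a sweep near a hole**: a radius `n₂ ∈ (13/10, 27/20)` along the unit
direction `v` from `c_j` with potential `< 24/25`. [folklore] -/
theorem exists_far_endpoint (j : Fin k) {v : ℂ} (hv : ‖v‖ = 1) :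
    ∃ n₂ : ℝ, 13 / 10 < n₂ ∧ n₂ < 27 / 20 ∧ planarPot k (holeCentre k j + (n₂ : ℂ) * v) < 24 / 25 := by
  have hlt := planarPot_lt_at_edge j hv (k := k)
  have hann : ∀ n : ℝ, 1 / 2 < n → n ≤ 27 / 20 → ∀ i : Fin k, holeCentre k j + (n : ℂ) * v ≠ holeCentre k i := by
    intro n h1 h2 i
    have hr : ‖holeCentre k j + (n : ℂ) * v - holeCentre k j‖ = n := by
      rw [add_sub_cancel_left, norm_mul, Complex.norm_real, hv, mul_one, Real.norm_of_nonneg (by linarith)]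
    by_cases hij : i = j
    · subst hij
      intro h; rw [h, sub_self, norm_zero] at hr; linarith
    · intro h
      have := norm_sub_holeCentre_ge_of_near (hr.le.trans h2) hij
      rw [h, sub_self, norm_zero] at this; linarith
  have hray : Continuous fun n : ℝ ↦ holeCentre k j + (n : ℂ) * v := by fun_prop
  have hcont : ContinuousAt (fun n : ℝ ↦ planarPot k (holeCentre k j + (n : ℂ) * v)) (27 / 20) :=
    ContinuousAt.comp (f := fun n : ℝ ↦ holeCentre k j + (n : ℂ) * v) (x := (27 / 20 : ℝ))
      ((contDiffAt_planarPot (n := ∞) (hann _ (by norm_num) le_rfl)).continuousAt) hray.continuousAt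
  have hev : ∀ᶠ n : ℝ in nhdsWithin ((27 : ℝ) / 20) (Iio ((27 : ℝ) / 20)),
      planarPot k (holeCentre k j + (n : ℂ) * v) < 24 / 25 :=
    Filter.Eventually.filter_mono nhdsWithin_le_nhds (hcont.preimage_mem_nhds
      (Iio_mem_nhds (show planarPot k (holeCentre k j + (((27 : ℝ) / 20 : ℝ) : ℂ) * v) < 24 / 25 by linarith)))
  obtain ⟨n₂, hn₂, hmem⟩ := (hev.and (Ioo_mem_nhdsLT (show (13 : ℝ) / 10 < 27 / 20 by norm_num))).exists
  exact ⟨n₂, hmem.1, hmem.2, hn₂⟩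

/-- Continuity of the potential along a ray from `c_j` on `[1, 27/20)`. [folklore] -/
theorem continuousOn_planarPot_ray (j : Fin k) {v : ℂ} (hv : ‖v‖ = 1) {n₂ : ℝ} (hn₂ : n₂ < 27 / 20) :
    ContinuousOn (fun n : ℝ ↦ planarPot k (holeCentre k j + (n : ℂ) * v)) (Icc 1 n₂) := by
  intro n hn
  have hne : ∀ i : Fin k, holeCentre k j + (n : ℂ) * v ≠ holeCentre k i := by
    intro i
    have hr : ‖holeCentre k j + (n : ℂ) * v - holeCentre k j‖ = n := by
      rw [add_sub_cancel_left, norm_mul, Complex.norm_real, hv, mul_one, Real.norm_of_nonneg (by linarith [hn.1])]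
    by_cases hij : i = j
    · subst hij
      intro h; rw [h, sub_self, norm_zero] at hr; linarith [hn.1]
    · intro h
      have := norm_sub_holeCentre_ge_of_near (show ‖holeCentre k j + (n : ℂ) * v - holeCentre k j‖ ≤ 27 / 20 by
        rw [hr]; linarith [hn.2]) hij
      rw [h, sub_self, norm_zero] at this; linarith
  have hray : Continuous fun n : ℝ ↦ holeCentre k j + (n : ℂ) * v := by fun_prop
  exact (ContinuousAt.comp (f := fun n : ℝ ↦ holeCentre k j + (n : ℂ) * v) (x := n)
    ((contDiffAt_planarPot (n := ∞) hne).continuousAt) hray.continuousAt).continuousWithinAt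

/-- **The inner endpoint of a sweep near a hole**: a radius `n₁ ∈ [1, n₂]` with prescribed
potential `1 − μ ∈ (g(n₂), 1]`. [folklore] -/
theorem exists_near_endpoint (j : Fin k) {v : ℂ} (hv : ‖v‖ = 1) {n₂ : ℝ} (hn₂1 : 1 ≤ n₂) (hn₂ : n₂ < 27 / 20)
    {μ : ℝ} (hμ0 : 0 ≤ μ) (hμ : planarPot k (holeCentre k j + (n₂ : ℂ) * v) ≤ 1 - μ) :
    ∃ n₁ ∈ Icc 1 n₂, planarPot k (holeCentre k j + (n₁ : ℂ) * v) = 1 - μ := by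
  have h1 : 1 - μ ≤ planarPot k (holeCentre k j + ((1 : ℝ) : ℂ) * v) := by
    have hne : holeCentre k j + ((1 : ℝ) : ℂ) * v ≠ holeCentre k j := by
      intro h
      have : ((1 : ℝ) : ℂ) * v = 0 := by simpa using congrArg (· - holeCentre k j) h
      rw [Complex.ofReal_one, one_mul] at this
      rw [this, norm_zero] at hv; exact zero_ne_one hv
    have := one_le_planarPot_of_norm_le_one hne (by
      rw [add_sub_cancel_left, norm_mul, Complex.norm_real, hv, mul_one]; simp)
    linarith [hμ0]
  obtain ⟨n₁, hn₁, heq⟩ := intermediate_value_Icc' hn₂1 (continuousOn_planarPot_ray j hv hn₂) ⟨hμ, h1⟩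
  exact ⟨n₁, hn₁, heq⟩

/-! ## The endpoints of the sweeps in the far zone -/

/-- The outer potential along the ray of `toC e`, `|e| = 1`, at radius `n > 0`. [folklore] -/
theorem outerPot_ray {e : 𝔼 2} (he : ‖e‖ = 1) {n : ℝ} (hn : 0 < n) :
    outerPot k (0 + (n : ℂ) * toC e) = planarPot k (outerZ k e n) := by
  have hv : ‖toC e‖ = 1 := by rw [norm_toC, he]
  rw [outerPot, latCoordInv, unitDir_ray hv hn, toE2_toC, zero_add, norm_mul, Complex.norm_real, hv,
    mul_one, Real.norm_of_nonneg hn.le]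

/-- At `s = c_k + 1/60` the meridian potential is `< 19/20`. [folklore] -/
theorem planarPot_outerZ_lt_at_far_edge {e : 𝔼 2} (he : ‖e‖ = 1) :
    planarPot k (outerZ k e (latC k + 1 / 60)) < 19 / 20 := by
  have hc1 := lt_latC (k := k)
  have hc2 := latC_lt (k := k)
  have hk : (0 : ℝ) ≤ k := Nat.cast_nonneg k
  have hband : latC k + 1 / 60 ∈ outerBand k := ⟨by linarith, by linarith⟩
  exact planarPot_outerZ_lt_of_high he le_rfl (by linarith) (by linarith [le_norm_outerZ he hband])

/-- **The inner endpoint of a sweep in the far zone**: a latitude `n₁ ∈ [c_k − 1/100, c_k + 1/60]`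
with prescribed meridian potential `1 − μ`, `0 ≤ μ ≤ 1/20`. [folklore] -/
theorem exists_far_near_endpoint {e : 𝔼 2} (he : ‖e‖ = 1) {μ : ℝ} (hμ0 : 0 ≤ μ) (hμ : μ ≤ 1 / 20) :
    ∃ n₁ ∈ Icc (latC k - 1 / 100) (latC k + 1 / 60), planarPot k (outerZ k e n₁) = 1 - μ := by
  have hc1 := lt_latC (k := k)
  have hc2 := latC_lt (k := k)
  have hsub : Icc (latC k - 1 / 100) (latC k + 1 / 60) ⊆ outerBand k := fun s hs ↦
    ⟨by linarith [hs.1], by linarith [hs.2]⟩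
  have hcont : ContinuousOn (fun s : ℝ ↦ planarPot k (outerZ k e s)) (Icc (latC k - 1 / 100) (latC k + 1 / 60)) :=
    fun s hs ↦ (exists_hasDerivAt_planarPot_outerZ he (hsub hs)).choose_spec.1.continuousAt.continuousWithinAt
  have h1 : 1 - μ ≤ planarPot k (outerZ k e (latC k - 1 / 100)) := by
    have := one_lt_planarPot_outerZ he (s := latC k - 1 / 100) (by linarith) (by linarith) (k := k)
    linarith
  have h2 : planarPot k (outerZ k e (latC k + 1 / 60)) ≤ 1 - μ := by
    have := planarPot_outerZ_lt_at_far_edge he (k := k); linarith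
  obtain ⟨n₁, hn₁, heq⟩ := intermediate_value_Icc' (by linarith) hcont ⟨h2, h1⟩
  exact ⟨n₁, hn₁, heq⟩

/-! ## Existence of preimages of virtual data -/

/-- The compression profile at a ray point of potential `≥ 1 − η` is `ρ(√(1 − g))` (`η > 0`).
[folklore] -/
theorem profF_rayPt_of_high (hη : 0 < η) {c : ℂ} {ĝ : ℂ → ℝ} {v e : ℂ} (he : ‖e‖ = 1) {n : ℝ}
    (hg : 1 - η ≤ ĝ (c + (n : ℂ) * v)) :
    profF c ĝ (cutoff η) (rayPt c ĝ v e n) = thinRad (Real.sqrt (1 - ĝ (c + (n : ℂ) * v))) := by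
  rw [profF, rayPt]
  simp only
  rw [cutoff_eq_one hη hg, norm_mul, Complex.norm_real, he, mul_one,
    Real.norm_of_nonneg (Real.sqrt_nonneg _)]
  ring

/-- The compression profile at a ray point of potential `≤ 1 − 3η/2` is the radius (`η > 0`,
`|v| = 1`, `n ≥ 0`). [folklore] -/
theorem profF_rayPt_of_low (hη : 0 < η) {c : ℂ} {ĝ : ℂ → ℝ} {v e : ℂ} (hv : ‖v‖ = 1) {n : ℝ}
    (hn : 0 ≤ n) (hg : ĝ (c + (n : ℂ) * v) ≤ 1 - 3 * η / 2) :
    profF c ĝ (cutoff η) (rayPt c ĝ v e n) = n := by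
  rw [profF, rayPt]
  simp only
  rw [cutoff_eq_zero hη hg, add_sub_cancel_left, zero_mul, zero_add, sub_zero, one_mul, norm_mul,
    Complex.norm_real, hv, mul_one, Real.norm_of_nonneg hn]

/-- `ρ(√μ) ≤ f` when `μ ≤ f²`, `f ≥ 0`. [folklore] -/
theorem thinRad_sqrt_le {μ f : ℝ} (hμ : μ ≤ f ^ 2) (hf : 0 ≤ f) :
    thinRad (Real.sqrt μ) ≤ f := by
  have h1 := thinRad_le_half_self (Real.sqrt_nonneg μ)
  have h2 : Real.sqrt μ ≤ f := by
    rw [show f = Real.sqrt (f ^ 2) by rw [Real.sqrt_sq hf]]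
    exact Real.sqrt_le_sqrt hμ
  linarith [Real.sqrt_nonneg μ]

/-- **Preimages near a hole**: a virtual planar point `ζ` in the punctured disc of radius `27/20`
about `c_j` with potential `> 1 − 3η/2`, seen from any unit direction, is the virtual datum of a
point of `M_k` off the cores (`0 < η ≤ 1/40`). [folklore] -/
theorem exists_virt_near (hη : 0 < η) (hη' : η ≤ 1 / 40) {j : Fin k} {ζ e : ℂ}
    (hj : ‖ζ - holeCentre k j‖ < 27 / 20) (h0 : ζ ≠ holeCentre k j) (he : ‖e‖ = 1)
    (hg : 1 - 3 * η / 2 < planarPot k ζ) :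
    ∃ p ∈ Mset k, p.2 ≠ 0 ∧ zmod k η p = ζ ∧ unitDir 0 p.2 = e := by
  set c := holeCentre k j
  set f := ‖ζ - c‖ with hf
  set v := unitDir c ζ with hvdef
  have hv : ‖v‖ = 1 := norm_unitDir h0
  have hf0 : 0 < f := norm_pos_iff.2 (sub_ne_zero.2 h0)
  have hζ : c + (f : ℂ) * v = ζ := by
    rw [hf, hvdef, norm_mul_unitDir]; abel
  -- the far endpoint
  obtain ⟨n₂, hn13, hn₂, hgn₂⟩ := exists_far_endpoint j hv (k := k)
  have hgn₂' : planarPot k (c + (n₂ : ℂ) * v) ≤ 1 - 3 * η / 2 := by linarith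
  -- `f < n₂` by monotonicity
  have hmono := planarPot_ray_strictAntiOn (k := k) j hv
  have hfn₂ : f < n₂ := by
    by_contra hle
    push Not at hle
    have h := hmono.antitoneOn (a := n₂) (b := f) ⟨by linarith, hn₂.le⟩ ⟨hf0, hj.le⟩ hle
    simp only [Complex.real_smul] at h
    rw [hζ] at h
    linarith
  -- the near endpoint with potential `1 − μ`
  set μ := min (η / 2) (f ^ 2) with hμ
  have hμ0 : 0 < μ := lt_min (by linarith) (by positivity)
  have hμη : μ ≤ η / 2 := min_le_left _ _
  have hμf : μ ≤ f ^ 2 := min_le_right _ _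
  have hn₂1 : 1 ≤ n₂ := by linarith
  obtain ⟨n₁, hn₁, hgn₁⟩ := exists_near_endpoint j hv hn₂1 hn₂ hμ0.le (by linarith)
  -- the sweep
  have hmem := mem_image_thetaB_of_ivt (c := c) (ĝ := planarPot k) (a₁ := 1 / 2) (a₂ := 27 / 20)
    (m₀ := 2) (by norm_num) (contDiff_cutoff η) (inner_radial j) hv he (n₁ := n₁) (n₂ := n₂)
    (by linarith [hn₁.1]) hn₁.2 hn₂ (by rw [hgn₁]; linarith) (by
      have := (inner_pos j (c + (n₂ : ℂ) * v) ⟨by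
        rw [add_sub_cancel_left, norm_mul, Complex.norm_real, hv, mul_one, Real.norm_of_nonneg (by linarith)]
        linarith, by
        rw [add_sub_cancel_left, norm_mul, Complex.norm_real, hv, mul_one, Real.norm_of_nonneg (by linarith)]
        exact hn₂⟩)
      linarith) two_pos (f := f)
    (by rw [profF_rayPt_of_high hη he (by rw [hgn₁]; linarith), hgn₁, sub_sub_cancel]
        exact thinRad_sqrt_le hμf hf0.le)
    (by rw [profF_rayPt_of_low hη hv (by linarith) hgn₂']; exact hfn₂.le)
  rw [hζ] at hmem
  obtain ⟨p, ⟨hpz, hpw, -⟩, hΘ⟩ := hmem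
  have hsnd : (thetaB c (planarPot k) (cutoff η) p).2 = e := by rw [hΘ]
  have hlev : planarPot k p.1 + ‖p.2‖ ^ 2 = 1 :=
    level_of_norm_thetaB_snd hpw (inner_pos j _ hpz) (by rw [hsnd, he])
  refine ⟨p, mem_Mset_of_level_near hpz hpw hlev, hpw, ?_, ?_⟩
  · rw [zmod_of_near hpz]; exact congrArg Prod.fst hΘ
  · rw [← thetaB_snd_of_level (c := c) (χ := cutoff η) hlev, hsnd]

/-- **Preimages in the far zone**: a far virtual planar point (`|ζ| ≥ 20(k+1)`, `Re ζ + C_k > 0`)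
with potential `> 1 − 3η/2`, seen from any unit direction, is the virtual datum of a point of
`M_k` off the cores (`0 < η ≤ 1/40`). [folklore] -/
theorem exists_virt_far (hη : 0 < η) (hη' : η ≤ 1 / 40) {ζ e : ℂ} (hfar : 20 * ((k : ℝ) + 1) ≤ ‖ζ‖)
    (hre : 0 < ζ.re + drawRadius k) (he : ‖e‖ = 1) (hg : 1 - 3 * η / 2 < planarPot k ζ) :
    ∃ p ∈ Mset k, p.2 ≠ 0 ∧ zmod k η p = ζ ∧ unitDir 0 p.2 = e := by
  have hk : (0 : ℝ) ≤ k := Nat.cast_nonneg k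
  have hc1 := lt_latC (k := k)
  have hc2 := latC_lt (k := k)
  -- off the focus, positive latitude at most `c + 1/60`
  have hco : coLat k ζ ≠ 0 := by
    intro h
    have := eq_focus_of_coLat_eq_zero hre.le h
    rw [this] at hfar
    linarith [norm_focus_lt (k := k)]
  set s := latS k ζ with hsdef
  have hs0 : 0 < s := div_pos (mul_pos (mul_pos two_pos focal_pos) hre) (outerDen_pos _)
  have hs1 : s < 1 := latS_lt_one_of_coLat_ne_zero hco
  have hsle : s ≤ latC k + 1 / 60 := by
    by_contra h
    push Not at h
    have := planarPot_lt_of_latS_gt hfar hco h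
    linarith
  set ê := coLatDir k ζ with hê
  have hê1 : ‖ê‖ = 1 := norm_coLatDir hco
  set v := toC ê with hvdef
  have hv : ‖v‖ = 1 := by rw [hvdef, norm_toC, hê1]
  have hΛ : (0 : ℂ) + (s : ℂ) * v = latCoord k ζ := by rw [zero_add, latCoord]
  -- endpoints
  set n₂ := latC k + 1 / 60 with hn₂
  have hgn₂ : outerPot k (0 + (n₂ : ℂ) * v) < 19 / 20 := by
    rw [outerPot_ray hê1 (by linarith)]; exact planarPot_outerZ_lt_at_far_edge hê1
  set μ := min (η / 2) (s ^ 2) with hμ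
  have hμ0 : 0 < μ := lt_min (by linarith) (by positivity)
  have hμη : μ ≤ η / 2 := min_le_left _ _
  have hμs : μ ≤ s ^ 2 := min_le_right _ _
  obtain ⟨n₁, hn₁, hgn₁⟩ := exists_far_near_endpoint hê1 hμ0.le (by linarith) (k := k)
  have hgn₁' : outerPot k (0 + (n₁ : ℂ) * v) = 1 - μ := by
    rw [outerPot_ray hê1 (by linarith [hn₁.1])]; exact hgn₁
  -- the sweep
  have hmem := mem_image_thetaB_of_ivt (c := (0 : ℂ)) (ĝ := outerPot k) (a₁ := latC k - 1 / 50)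
    (a₂ := latC k + 1 / 50) (m₀ := 2) (by linarith) (contDiff_cutoff η) outer_radial hv he
    (n₁ := n₁) (n₂ := n₂) (by linarith [hn₁.1]) hn₁.2 (by linarith) (by rw [hgn₁']; linarith)
    (by have := outer_pos (k := k) (0 + (n₂ : ℂ) * v) ⟨by
          rw [sub_zero, zero_add, norm_mul, Complex.norm_real, hv, mul_one, Real.norm_of_nonneg (by linarith)]
          linarith, by
          rw [sub_zero, zero_add, norm_mul, Complex.norm_real, hv, mul_one, Real.norm_of_nonneg (by linarith)]
          linarith⟩
        linarith) two_pos (f := s)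
    (by rw [profF_rayPt_of_high hη he (by rw [hgn₁']; linarith), hgn₁', sub_sub_cancel]
        exact thinRad_sqrt_le hμs hs0.le)
    (by rw [profF_rayPt_of_low hη hv (by linarith) (by linarith)]; exact hsle)
  rw [hΛ] at hmem
  obtain ⟨q, ⟨hann, hqw, -⟩, hΘ⟩ := hmem
  obtain ⟨hq0, -, hq1, hband⟩ := outer_annulus_bounds hann
  have hsnd : (thetaB 0 (outerPot k) (cutoff η) q).2 = e := by rw [hΘ]
  have hlev : outerPot k q.1 + ‖q.2‖ ^ 2 = 1 :=
    level_of_norm_thetaB_snd hqw (outer_pos _ hann) (by rw [hsnd, he])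
  -- the point
  set p : ℂ × ℂ := (latCoordInv k q.1, q.2) with hpdef
  have heu : ‖toE2 (unitDir 0 q.1)‖ = 1 := by rw [norm_toE2, norm_unitDir hq0]
  have hfarp : 29 * ((k : ℝ) + 1) ≤ ‖p.1‖ := by
    show 29 * ((k : ℝ) + 1) ≤ ‖latCoordInv k q.1‖
    rw [latCoordInv]; exact le_norm_outerZ heu hband
  have hM : p ∈ Mset k := by
    refine ⟨fun i ↦ ?_, hlev⟩
    show 1 ≤ ‖latCoordInv k q.1 - holeCentre k i‖
    rw [latCoordInv]
    have := norm_outerZ_sub_holeCentre_ge heu hband i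
    have h1 : (1 : ℝ) ≤ 25 * ((k : ℝ) + 1) := by linarith
    linarith
  refine ⟨p, hM, hqw, ?_, ?_⟩
  · have hΛp : latCoord k p.1 = q.1 := latCoord_latCoordInv hq0 hq1
    rw [zmod_of_far (by linarith)]
    change latCoordInv k (thetaB 0 (outerPot k) (cutoff η) (latCoord k p.1, p.2)).1 = ζ
    rw [hΛp]
    change latCoordInv k (thetaB 0 (outerPot k) (cutoff η) (q.1, q.2)).1 = ζ
    rw [Prod.mk.eta, hΘ]
    exact latCoordInv_latCoord hco hs0
  · show unitDir 0 q.2 = e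
    rw [← thetaB_snd_of_level (c := (0 : ℂ)) (χ := cutoff η) hlev, hsnd]

/-! ## Existence of core preimages -/

/-- **Inner core preimages**: every circle direction is the direction of an inner core point of the
`j`-th core, with prescribed reflection (`0 < η`). [folklore] -/
theorem exists_core_inner (hη : 0 < η) (fl : Fin k → Bool) (j : Fin k) (b2 : 𝕊 1) :
    ∃ p ∈ Mset k, p.2 = 0 ∧ p ∈ zoneA k η j ∧ bPt k fl j p = (0, b2) := by
  set e := toC (flipE (fl j) (b2 : 𝔼 2)) with hedef
  have he : ‖e‖ = 1 := by rw [hedef, norm_toC, norm_flipE, norm_eq_of_mem_sphere]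
  obtain ⟨n₂, hn13, hn₂, hgn₂⟩ := exists_far_endpoint j he (k := k)
  have hmem := mem_image_thetaA_of_ivt (c := holeCentre k j) (ĝ := planarPot k) (a₁ := 1 / 2)
    (a₂ := 27 / 20) (m₀ := 1 / 5) (by norm_num) (inner_radial j) he (w := (0 : ℂ)) (by simp)
    (r₁ := 1) (r₂ := n₂) (by norm_num) (by linarith) hn₂
    (by
      rw [norm_zero]
      have hne : holeCentre k j + ((1 : ℝ) : ℂ) * e ≠ holeCentre k j := by
        intro h
        have : ((1 : ℝ) : ℂ) * e = 0 := by simpa using congrArg (· - holeCentre k j) h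
        rw [Complex.ofReal_one, one_mul] at this
        rw [this, norm_zero] at he; exact zero_ne_one he
      have := one_le_planarPot_of_norm_le_one hne (by
        rw [add_sub_cancel_left, norm_mul, Complex.norm_real, he, mul_one]; simp)
      linarith)
    (by rw [norm_zero]; linarith)
  obtain ⟨p, ⟨hpz, hw5⟩, hΘ⟩ := hmem
  have hpw : p.2 = 0 := congrArg Prod.snd hΘ
  have hlev : planarPot k p.1 + ‖p.2‖ ^ 2 = 1 := by
    rw [level_iff_norm_thetaA_fst (c := holeCentre k j) (a₂ := (27 : ℝ) / 20) (by norm_num) (inner_pos j) hpz,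
      hΘ, he]
  have hM := mem_Mset_of_level_annulus hpz hlev
  have hzone : p ∈ zoneA k η j := ⟨hpz, hw5, by rw [hpw, norm_zero] at hlev; linarith⟩
  refine ⟨p, hM, hpw, hzone, ?_⟩
  have hu : unitDir (holeCentre k j) p.1 = toC ((flipS (fl j) b2 : 𝕊 1) : 𝔼 2) := by
    have h1 := thetaA_of_level (c := holeCentre k j) hlev
    rw [hΘ] at h1
    rw [coe_flipS]; exact (congrArg Prod.fst h1).symm
  have hdir := holeDirS_eq_of_unitDir_eq (ne_centre_of_mem_annulus (by norm_num) hpz) hu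
  refine Prod.ext ?_ ?_
  · show toE2 (conj p.2) = 0
    rw [hpw, map_zero]; exact toE2_eq_zero_iff.2 rfl
  · show flipS (fl j) (holeDirS k j p.1) = b2
    rw [hdir, flipS_flipS]

/-- A unit vector of `ℝ⁴` with vanishing planar coordinates is an outer core point `outerPt e 0`.
[folklore] -/
theorem exists_outerPt_eq_of_axis {x : 𝔼 4} (hx : ‖x‖ = 1) (h0 : x 0 = 0) (h1 : x 1 = 0) :
    ∃ e : 𝔼 2, ‖e‖ = 1 ∧ outerPt k e 0 = x := by
  set v := dilCoe (focal k)⁻¹ x with hv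
  have hD := (dilDen_pos_of_norm_eq_one (inv_ne_zero (focal_ne_zero (k := k))) hx).ne'
  have hvn : ‖v‖ = 1 := norm_dilCoe hD hx
  have hv0 : proj01 v = 0 := by
    ext i
    fin_cases i
    · show dilCoe (focal k)⁻¹ x 0 = 0
      rw [dilCoe_apply_zero, h0]; simp
    · show dilCoe (focal k)⁻¹ x 1 = 0
      rw [dilCoe_apply_one, h1]; simp
  have hp1 : ‖proj01 v‖ < 1 := by rw [hv0, norm_zero]; exact one_pos
  refine ⟨(Real.sqrt (1 - ‖proj01 v‖ ^ 2))⁻¹ • proj23 v, norm_smul_proj23 hvn hp1, ?_⟩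
  have hax := axisTubeVec_proj hp1
  rw [hv0] at hax
  rw [outerPt, hv0, hax, hv]
  have := dilCoe_inv_dilCoe (inv_ne_zero (focal_ne_zero (k := k))) hD
  rwa [inv_inv] at this

/-- **Outer core preimages**: every point of the sphere with vanishing planar coordinates is the
outer core point of an outer core point of `M_k` (`0 < η`). [folklore] -/
theorem exists_core_outer (hη : 0 < η) (a : 𝕊 3) (h0 : (a : 𝔼 4) 0 = 0) (h1 : (a : 𝔼 4) 1 = 0) :
    ∃ p ∈ Mset k, p.2 = 0 ∧ p ∈ zoneO k η ∧ outS k p = a := by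
  have hk : (0 : ℝ) ≤ k := Nat.cast_nonneg k
  have hc1 := lt_latC (k := k)
  have hc2 := latC_lt (k := k)
  obtain ⟨e, he, hea⟩ := exists_outerPt_eq_of_axis (k := k) (norm_eq_of_mem_sphere a) h0 h1
  set v := toC e with hvdef
  have hv : ‖v‖ = 1 := by rw [hvdef, norm_toC, he]
  have hmem := mem_image_thetaA_of_ivt (c := (0 : ℂ)) (ĝ := outerPot k) (a₁ := latC k - 1 / 50)
    (a₂ := latC k + 1 / 50) (m₀ := 1 / 5) (by linarith) outer_radial hv (w := (0 : ℂ)) (by simp)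
    (r₁ := latC k - 1 / 100) (r₂ := latC k + 1 / 60) (by linarith) (by linarith) (by linarith)
    (by rw [norm_zero, outerPot_ray he (by linarith)]
        have := one_lt_planarPot_outerZ he (s := latC k - 1 / 100) (by linarith) (by linarith) (k := k)
        linarith)
    (by rw [norm_zero, outerPot_ray he (by linarith)]
        have := planarPot_outerZ_lt_at_far_edge he (k := k); linarith)
  obtain ⟨q, ⟨hann, hw5⟩, hΘ⟩ := hmem
  obtain ⟨hq0, hq0', hq1, hband⟩ := outer_annulus_bounds hann
  have hqw : q.2 = 0 := congrArg Prod.snd hΘ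
  have hlev : outerPot k q.1 + ‖q.2‖ ^ 2 = 1 := by
    rw [level_iff_norm_thetaA_fst (c := (0 : ℂ)) (a₂ := latC k + 1 / 50)
      (le_trans (by norm_num) half_le_outer_a₁) outer_pos hann, hΘ, hv]
  set p : ℂ × ℂ := (latCoordInv k q.1, q.2) with hpdef
  have heu : ‖toE2 (unitDir 0 q.1)‖ = 1 := by rw [norm_toE2, norm_unitDir hq0]
  have hfarp : 29 * ((k : ℝ) + 1) ≤ ‖p.1‖ := by
    show 29 * ((k : ℝ) + 1) ≤ ‖latCoordInv k q.1‖
    rw [latCoordInv]; exact le_norm_outerZ heu hband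
  have hM : p ∈ Mset k := by
    refine ⟨fun i ↦ ?_, hlev⟩
    show 1 ≤ ‖latCoordInv k q.1 - holeCentre k i‖
    rw [latCoordInv]
    have := norm_outerZ_sub_holeCentre_ge heu hband i
    have h1' : (1 : ℝ) ≤ 25 * ((k : ℝ) + 1) := by linarith
    linarith
  have hzone : p ∈ zoneO k η := by
    refine ⟨by linarith, by linarith [norm_fst_le_of_mem hM], ?_, ?_⟩
    · show ‖q.2‖ < 1 / 5
      exact hw5
    · have := hM.2
      show 1 - η < planarPot k (latCoordInv k q.1)
      change outerPot k q.1 + ‖q.2‖ ^ 2 = 1 at hlev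
      rw [hqw, norm_zero] at hlev
      change 1 - η < outerPot k q.1
      linarith
  refine ⟨p, hM, hqw, hzone, ?_⟩
  have hu : unitDir 0 q.1 = v := by
    have h1 := thetaA_of_level (c := (0 : ℂ)) hlev
    rw [hΘ] at h1
    exact (congrArg Prod.fst h1).symm
  have hdir : coLatDir k p.1 = e := by
    show coLatDir k (latCoordInv k q.1) = e
    rw [latCoordInv, coLatDir_outerZ heu hq0' hq1, hu, hvdef, toE2_toC]
  refine Subtype.ext ?_
  rw [coe_outS (coLat_ne_zero_of_mem_zoneO hzone), outVec, hdir]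
  have : squeeze (1 / 2) (toE2 (conj p.2)) = 0 := by
    show squeeze (1 / 2) (toE2 (conj q.2)) = 0
    rw [hqw, map_zero, toE2_eq_zero_iff.2 rfl, squeeze_zero]
  rw [this, hea]

/-! ## The covering -/

/-- The dotted circle in terms of the chart point of its centre. [folklore] -/
theorem dottedCircle_eq_stereoNorthInv_cpt (j : Fin k) (θ : 𝕊 1) :
    dottedCircle k j θ = stereoNorthInv (cpt k (holeCentre k j) (toC (θ : 𝔼 2))) := by
  rw [dottedCircle, ← toSphereThree_eq_stereoNorthInv]
  congr 1
  refine Prod.ext ?_ ?_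
  · simp only [cpt, dottedRadius, holeCentre, Complex.ofReal_re, Complex.re_ofReal_mul, toC_re]
  · simp only [cpt, dottedRadius, holeCentre, Complex.ofReal_re, Complex.im_ofReal_mul, toC_im]

section Cover

variable {Y : Type*} [TopologicalSpace Y] [ChartedSpace (𝔼 3) Y] (G : Gluing k η Y)

namespace Gluing

/-- A point of `M_k` off the cores with prescribed virtual chart point in the reading of a point of
the complement maps to that point. [folklore] -/
theorem map_eq_JA_of_virtC {a : 𝕊 3} (ha : a ∈ G.LC) (haN : a ≠ northPole) {p : ℂ × ℂ}
    (hp : p ∈ Mset k) (hw : p.2 ≠ 0) (hv : virtC k η p = stereoNorthCoords (a : 𝔼 4)) :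
    p ∈ G.Sset ∧ G.map p = G.JA a := by
  have hvirt : virtS k η p = a := by rw [virtS, hv, stereoNorthInv_stereoNorthCoords haN]
  have hmem : virtS k η p ∈ G.LC := by rw [hvirt]; exact ha
  exact ⟨⟨hp, G.not_mem_range_KC_of_virtS hmem⟩, by rw [G.map_eq_of_ne_zero hw, hvirt]⟩

/-- **Every point of the link complement is hit**: `JA a ∈ G.map '' (M_k ∖ K)` for `a ∈ LC`.
[folklore] -/
theorem mem_image_of_mem_LC {a : 𝕊 3} (ha : a ∈ G.LC) : G.JA a ∈ G.map '' G.Sset := by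
  have hη := G.hη
  have hη' := G.hη'
  have hk : (0 : ℝ) ≤ k := Nat.cast_nonneg k
  by_cases hax : (a : 𝔼 4) 0 = 0 ∧ (a : 𝔼 4) 1 = 0
  · -- on the axis circle: an outer core point
    obtain ⟨p, hM, hw, hzone, hout⟩ := exists_core_outer hη a hax.1 hax.2 (k := k)
    refine ⟨p, ⟨hM, G.not_mem_range_KC_of_pot hzone.2.2.2⟩, ?_⟩
    rw [show G.map p = G.JA (outS k p) from modelMap_of_mem_zoneO hzone, hout]
  · -- off the axis: a virtual sphere point
    have haN : a ≠ northPole := by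
      rintro rfl
      exact hax ⟨by simp [coe_northPole], by simp [coe_northPole]⟩
    have h3 := apply_three_ne_one_of_ne_northPole haN
    have h3' : (1 : ℝ) - (a : 𝔼 4) 3 ≠ 0 := sub_ne_zero.2 (Ne.symm h3)
    set ŷ := stereoNorthCoords (a : 𝔼 4) with hŷ
    have hC : chartC ŷ ≠ 0 := by
      intro h
      apply hax
      have hre := congrArg Complex.re h
      have him := congrArg Complex.im h
      rw [chartC_re, Complex.zero_re] at hre
      rw [chartC_im, Complex.zero_im] at him
      simp only [hŷ, stereoNorthCoords, mul_eq_zero, inv_eq_zero] at hre him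
      exact ⟨hre.resolve_left h3', him.resolve_left h3'⟩
    set ζ := chartZ k ŷ with hζ
    set u := dirC ŷ with hu
    have hu1 : ‖u‖ = 1 := norm_dirC hC
    have hcu1 : ‖conj u‖ = 1 := by rw [Complex.norm_conj, hu1]
    have hrec : cpt k ζ u = ŷ := cpt_chartZ_dirC ŷ
    have hre : 0 < ζ.re + drawRadius k := by
      rw [hζ, chartZ_re, sub_add_cancel]; exact norm_pos_iff.2 hC
    -- `ζ` is off the poles (else `a` is a dotted circle point)
    have hpole : ∀ j : Fin k, ζ ≠ holeCentre k j := by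
      intro j h
      haveI : Fact (Module.finrank ℝ (𝔼 2) = 1 + 1) := ⟨finrank_euclideanSpace_fin⟩
      set θ : 𝕊 1 := ⟨toE2 u, by rw [mem_sphere_zero_iff_norm, norm_toE2, hu1]⟩
      have : a = dottedCircle k j θ := by
        rw [dottedCircle_eq_stereoNorthInv_cpt, ← stereoNorthInv_stereoNorthCoords haN]
        congr 1
        rw [← hŷ, ← hrec, h]
        show cpt k (holeCentre k j) u = cpt k (holeCentre k j) (toC (toE2 u))
        rw [toC_toE2]
      exact G.LC_dotted j θ (this ▸ ha)
    -- the preimage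
    suffices hex : ∃ p ∈ Mset k, p.2 ≠ 0 ∧ zmod k η p = ζ ∧ unitDir 0 p.2 = conj u by
      obtain ⟨p, hM, hw, hz, hd⟩ := hex
      have hv : virtC k η p = ŷ := by rw [virtC, hz, hd, Complex.conj_conj, hrec]
      obtain ⟨hS, hmap⟩ := G.map_eq_JA_of_virtC ha haN hM hw hv
      exact ⟨p, hS, hmap⟩
    by_cases hlow : planarPot k ζ ≤ 1 - 3 * η / 2
    · -- no compression: the chart lift
      have hg1 : planarPot k ζ < 1 := by linarith
      have hsq : 0 < Real.sqrt (1 - planarPot k ζ) := Real.sqrt_pos.2 (by linarith)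
      refine ⟨(ζ, ((Real.sqrt (1 - planarPot k ζ) : ℝ) : ℂ) * conj u), ⟨fun j ↦ ?_, ?_⟩, ?_, ?_, ?_⟩
      · by_contra hlt
        push Not at hlt
        have := one_le_planarPot_of_norm_le_one (hpole j) hlt.le
        linarith
      · show planarPot k ζ + ‖((Real.sqrt (1 - planarPot k ζ) : ℝ) : ℂ) * conj u‖ ^ 2 = 1
        rw [norm_mul, Complex.norm_real, hcu1, mul_one, Real.norm_of_nonneg hsq.le,
          Real.sq_sqrt (by linarith)]
        ring
      · exact mul_ne_zero (by exact_mod_cast hsq.ne') (by rw [← norm_ne_zero_iff, hcu1]; exact one_ne_zero)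
      · refine zmod_of_cutoff_eq_zero (cutoff_eq_zero hη hlow) ?_
        show ‖ζ‖ < drawRadius k
        have hg := hg1
        rw [planarPot_eq_bigRadius] at hg
        have hsum : 0 ≤ ∑ j : Fin k, 1 / Complex.normSq (ζ - holeCentre k j) :=
          Finset.sum_nonneg fun j _ ↦ one_div_nonneg.2 (Complex.normSq_nonneg _)
        have hR := bigRadius_pos (k := k)
        have h1 : Complex.normSq ζ / bigRadius k ^ 2 < 1 := by linarith
        rw [div_lt_one (by positivity), Complex.normSq_eq_norm_sq, bigRadius] at h1
        have h40 : (0 : ℝ) ≤ 40 * ((k : ℝ) + 1) := by positivity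
        have : ‖ζ‖ < 40 * ((k : ℝ) + 1) := by nlinarith [norm_nonneg ζ]
        unfold drawRadius; linarith
      · show unitDir 0 (((Real.sqrt (1 - planarPot k ζ) : ℝ) : ℂ) * conj u) = conj u
        have := unitDir_ray (c := (0 : ℂ)) hcu1 hsq
        rwa [zero_add] at this
    · push Not at hlow
      have h1920 : 19 / 20 ≤ planarPot k ζ := by linarith
      rcases far_or_near_of_le_planarPot h1920 with hfar | ⟨j, hj⟩
      · rw [bigRadius] at hfar
        exact exists_virt_far hη hη' (by linarith) hre hcu1 hlow
      · exact exists_virt_near hη hη' hj (hpole j) hcu1 hlow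

/-- **The covering**: every point of `Y` lies in `G.map '' (M_k ∖ K)` or in the last glued-in open
solid torus. [folklore] -/
theorem cover' (y : Y) : y ∈ G.map '' G.Sset ∨ ∃ b : (𝔼 2) × (𝕊 1), ‖b.1‖ < 1 ∧ G.JB (Fin.last k) b = y := by
  rcases G.cover y with ⟨a, ha, rfl⟩ | ⟨i, b, hb, rfl⟩
  · exact Or.inl (G.mem_image_of_mem_LC ha)
  · induction i using Fin.lastCases with
    | last => exact Or.inr ⟨b, hb, rfl⟩
    | cast j =>
      left
      by_cases hb0 : b.1 = 0
      · obtain ⟨p, hM, hw, hzone, hbPt⟩ := exists_core_inner G.hη G.fl j b.2 (k := k)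
        refine ⟨p, ⟨hM, G.not_mem_range_KC_of_pot hzone.2.2⟩, ?_⟩
        rw [show G.map p = G.JB (Fin.castSucc j) (bPt k G.fl j p) from modelMap_of_mem_zoneA hzone, hbPt]
        congr 1
        exact Prod.ext hb0.symm rfl
      · -- a glued point of the punctured torus is a point of the complement
        set t := ‖b.1‖ with ht
        have ht0 : 0 < t := norm_pos_iff.2 hb0
        set u : 𝕊 1 := radialProjection (circlePoint 0) b.1 with hu
        have hbu : b.1 = t • (u : 𝔼 2) := by
          rw [hu, coe_radialProjection_of_ne_zero _ hb0, smul_smul, ht, mul_inv_cancel₀ ht0.ne', one_smul]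
        set a := dottedTubeFun k j (u, t • flipE (G.fl j) (b.2 : 𝔼 2)) with hadef
        have hv : t • flipE (G.fl j) (b.2 : 𝔼 2) ≠ 0 :=
          smul_ne_zero ht0.ne' (by rw [← norm_ne_zero_iff, norm_flipE, norm_eq_of_mem_sphere]; exact one_ne_zero)
        have haLC : a ∈ G.LC := G.tubeA_mem j u _ hv (by
          rw [norm_smul, Real.norm_of_nonneg ht0.le, norm_flipE, norm_eq_of_mem_sphere, mul_one]; exact hb)
        have hglue : G.JA a = G.JB (Fin.castSucc j) b := (G.glueA j a haLC b hb).2 ⟨u, t, ⟨ht0, hb⟩, hbu, rfl⟩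
        rw [← hglue]
        exact G.mem_image_of_mem_LC haLC

/-! ## The glue relation of the last torus -/

/-- **The glue relation between the model map and the last glued-in solid torus.** [folklore] -/
theorem map_eq_JB_last_iff {p : ℂ × ℂ} (hp : p ∈ G.Sset) {b : (𝔼 2) × (𝕊 1)} (hb : ‖b.1‖ < 1) :
    G.map p = G.JB (Fin.last k) b ↔ ∃ (u : 𝕊 1) (t : ℝ), t ∈ Ioo (0 : ℝ) 1 ∧ b.1 = t • (u : 𝔼 2) ∧
      p.2 ≠ 0 ∧ planarPot k p.1 < 1 - 3 * η ∧ virtS k η p = G.T' (u, t • (b.2 : 𝔼 2)) := by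
  have hη := G.hη
  have hη' := G.hη'
  constructor
  · intro h
    by_cases hw : p.2 = 0
    · exfalso
      rcases mem_zone_of_core hη hη' hp.1 hw with ⟨j, hj⟩ | ho
      · rw [show G.map p = G.JB (Fin.castSucc j) (bPt k G.fl j p) from modelMap_of_mem_zoneA hj] at h
        have hb' : ‖(bPt k G.fl j p).1‖ < 1 := by rw [norm_bPt_fst, hw, norm_zero]; exact one_pos
        exact G.JB_disj _ _ _ _ (Fin.castSucc_lt_last j).ne hb' hb h
      · rw [show G.map p = G.JA (outS k p) from modelMap_of_mem_zoneO ho] at h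
        obtain ⟨u, t, ht, -, hout⟩ := (G.glueL _ (G.outS_mem p ho) b hb).1 h
        obtain ⟨p', hp', hw', -, hv'⟩ := G.T'_spec u (t • (b.2 : 𝔼 2)) (by
          rw [norm_smul, Real.norm_of_nonneg ht.1.le, norm_eq_of_mem_sphere, mul_one]; exact ht.2)
        rw [← hv'] at hout
        obtain ⟨h0, h1⟩ := outS_core_apply ho hw
        rw [hout] at h0 h1
        rcases virtS_apply_ne hη hη' hp' hw' with h' | h'
        · exact h' h0
        · exact h' h1
    · rw [G.map_eq_of_ne_zero hw] at h
      obtain ⟨u, t, ht, hbu, hv⟩ := (G.glueL _ (G.virt_mem p hp.1 hp.2 hw) b hb).1 h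
      obtain ⟨p', hp', hw', hg', hv'⟩ := G.T'_spec u (t • (b.2 : 𝔼 2)) (by
        rw [norm_smul, Real.norm_of_nonneg ht.1.le, norm_eq_of_mem_sphere, mul_one]; exact ht.2)
      have heq : p = p' := by
        obtain ⟨h1, h2⟩ := zmod_eq_of_virtS_eq hη hη' hp.1 hp' hw hw' (by rw [hv, hv'])
        exact eq_of_zmod_eq hη hη' hp.1 hp' hw hw' h1 h2
      subst heq
      exact ⟨u, t, ht, hbu, hw, hg', hv⟩
  · rintro ⟨u, t, ht, hbu, hw, -, hv⟩
    rw [G.map_eq_of_ne_zero hw]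
    exact (G.glueL _ (G.virt_mem p hp.1 hp.2 hw) b hb).2 ⟨u, t, ht, hbu, hv⟩

end Gluing

end Cover

end MMSW

end Literature.Topology.FourManifolds
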